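import Summits.MatrixMultiplication.MatrixMultiplication.Theses.ThinBlockAlpha

/-!
# Disproof of `SkewLocalStrongUSP` — findings (crux stmt-MatrixMultiplication-10598, route ThinBlockAlpha)

Standing crux-disprover work file (cdisprove seat `refuter-cdisprove-stmt-MatrixMultiplication-10598-0`,
cycle 1, 2026-08-16).  VERDICT SO FAR: **no kill; the crux is a genuine open capacity question**
(probably false, but unrefutable with every tool we have — quantified below).  Everything in §0–§3 is
`sorry`-free; §3 is conditional on Füredi's 1984 threshold theorem (stated as a `Prop`, cited);
§4 is documentation (numbers anchored by `example`s and by `paradigm/proxy_enum.py` in the seat folder,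
attached as item evidence).

THE CRUX (`crux_iff`): for every `δ > 0` and infinitely many `k` there is `U ⊆ {0,1,2}^{7k}`, all rows
of composition `(3k, k, 3k)` (zeros, ones, twos), such that every ordered triple `(u,v,w) ∈ U³` not all
equal has a column with exactly two of `u_i = 0, v_i = 1, w_i = 2` (CKSU local strong USP, §6.1), and
`C(7k,k) ≤ 2^{δk} |U|`.

## Findings index
* §0 `CruxAt`, `crux_iff` — the crux with `δ, k` exposed (by `Iff.rfl`); `cruxAt_zero` (k = 0 degenerate).
* §1 DICTIONARY AND CAP (proved; = proposal `Theorems/SkewLocalStrongUSP/Negative/PiecesCapAndSandwich.lean`):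
  `no_witness_iff` (a triple has no admissible column iff `Z(u) ∩ O(v) = Z(u) ∩ T(w) = O(v) ∩ T(w)`,
  a Δ-system), `oneSet_injOn` + `card_le_choose` (`|U| ≤ C(7k,k)`: the crux asks for the unique-pieces
  cap up to `2^{-δk}`), `oneSet_ne_of_sandwich` (FORBIDDEN ONE-SETS: for rows `u ≠ w` with kernel
  `K = Z(u) ∩ T(w)`, no row may have `K ⊆ O(v) ⊆ K ∪ (Z(u) ∪ T(w))ᶜ`; for `|K| = j ≤ k` that is
  `C(k+j, 2j)` forbidden `k`-sets, for `j > k` NOTHING — and `j ≈ 9k/7 > k` is the typical value),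
  `lt_card_inter_of_choose_le_card` (a cap-meeting family has `|Z(u) ∩ T(w)| ≥ k+1` for all `u ≠ w`).
* §2 WHAT IS LOAD-BEARING (the crux is existential, so we record which CONSTRAINT carries the
  difficulty rather than `_false_without_` lemmas):
  (a) `exists_witness_of_common_oneSet`: drop the degenerate triples (require the column only for
      pairwise distinct `u,v,w`) and the statement is TRIVIALLY TRUE — all `C(6k,3k) ≫ C(7k,k)` rows with
      one fixed one-set qualify.  The degenerate triples force injectivity of `u ↦ Z(u), O(u), T(u)`.
  (b) (paper, §4 NEW 4) drop the NONEMPTY-KERNEL Δ-systems (forbid only `Z(u) ⊔ O(v) ⊔ T(w) = [7k]`, the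
      local WEAK USP within the skew type) and the statement is TRUE by the Coppersmith–Winograd /
      Salem–Spencer hashing construction (heuristic count in NOTES: modulus `M ≈ 2^{6k}`, surviving rows
      `C(7k,k)^{1-o(1)}`, bad distinct triples `→ 0`).  So ALL the content is in kernels `1 ≤ |K| ≤ k`,
      exactly as for CKSU's strong-vs-weak USP capacity (the balanced strong USP conjecture is false,
      BCCGNSU 2017 §1; its skew analogue is this crux).
* §3 NATURAL STRENGTHENING REFUTED (mod Füredi): `CruxExact` (the slack `2^{δk}` replaced by `1`) is
  false: `card_le_of_exact_of_furedi` gives `|U| ≤ C(4k,2k)` for any cap-meeting family, and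
  `C(4k,2k) < C(7k,k)` for every `k ≥ 1` (`choose_four_two_lt`: checked by `decide` for `k ≤ 12`;
  asymptotically `2^{4k}` vs `2^{4.1417k}`).  STRUCTURAL COROLLARY for honest witnesses: the graph of
  "tight pairs" (`|Z(u) ∩ T(w)| ≤ k`) on a witness `U` has independence number `≤ C(4k,2k)`, hence
  `≥ |U|²/(2 C(4k,2k)) - |U|/2 ≈ 2^{(4.28-2δ)k}` tight pairs, each forbidding `≥ 1` one-set — but in the
  sparse regime `|U| = 2^{-6k}·#class` counting cannot convert this into a contradiction (a single
  absent `k`-set absorbs up to `2^{9.9k}` pairs).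
* §4 WHY IT RESISTS — the CKSU-embedding / slice-rank paradigm is PROVABLY silent at `a = 1/3`
  (new, quantitative; extends the route's `a₀(ℓ)` computation from CKSU's sets to ALL block choices):
  see the long comment in §4 and `paradigm/proxy_enum.py`.  Per-coordinate rates in bits
  (need `< h(1/7) = 0.5917` for a kill): CKSU sets + Thm B: `F₂ 0.918, F₃ 0.795, F₂² 0.780, F₅ 0.824,
  F₇ 0.899`; exhaustive over ALL special-set triples `(P,Q,R)` with the flattening-rank proxy (an upper
  bound on any degeneration value): the SAME numbers (argmax = CKSU's `P = Q = R = {0}`); all cyclic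
  prime `G` and `F₈, F₉` are excluded analytically (`Γ(G)/|G| ≥ 0.8414 > 0.79741 = (4/27)^{1/3}·2^{h(1/7)}`);
  the support-functional refinement `min_θ` is attained at `θ = (1,0,0)` = pure counting = `7⁷/6⁶`
  (`= 2^{7h(1/7)}` on the nose at `p = 7`).  Direct typed slice rank on `U` and the `F₂/F₃` indicator
  embeddings are ≥ the cap (prior seats, re-derived).  A refutation therefore needs a NEW upper-bound
  technique for 3-uniform directed Sperner capacity within a type (nothing in print: trifference-type
  problems have only counting/LP bounds); a proof needs a strong-USP-type construction beyond every
  known one (rate `2^{h(1/7)} = 1.507` inside the skew class; best small data: `k = 1` exact max `4/7`,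
  `k = 2` heuristic `≥ 29/91`, prior seats).
* §5 TARGETS — none yet (no line picked, `stuck_stubs = []`).
-/

namespace Summit.MatrixMultiplication.MatrixMultiplication.Cruxes.SkewLocalStrongUSP.Disproof

open Finset
open Summit.MatrixMultiplication.MatrixMultiplication.Theses.ThinBlockAlpha

/-! ## §0 The crux with its constants exposed -/

/-- `SkewLocalStrongUSP` at slack `δ` and size parameter `k`: a local strong USP in the class
`(3k, k, 3k)` of width `7k` with `C(7k,k) ≤ 2^{δk}|U|` (verbatim the matrix of the crux). -/
def CruxAt (δ : ℝ) (k : ℕ) : Prop :=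
  ∃ U : Finset (Fin (7 * k) → Fin 3), (∀ u ∈ U, ∀ v ∈ U, ∀ w ∈ U, (u ≠ v ∨ v ≠ w) → ∃ i,
    (u i, v i, w i) ∈ ({((0 : Fin 3), (1 : Fin 3), (0 : Fin 3)), (0, 1, 1), (0, 0, 2), (0, 2, 2),
      (1, 1, 2), (2, 1, 2)} : Finset (Fin 3 × Fin 3 × Fin 3))) ∧
    (∀ u ∈ U, (Finset.univ.filter fun i => u i = 0).card = 3 * k ∧
      (Finset.univ.filter fun i => u i = 1).card = k) ∧
    (Nat.choose (7 * k) k : ℝ) ≤ (2 : ℝ) ^ (δ * k) * U.card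

/-- The crux is `∀ δ > 0, ∀ k₀, ∃ k ≥ k₀, CruxAt δ k` — definitionally. -/
theorem crux_iff : SkewLocalStrongUSP ↔ ∀ δ : ℝ, 0 < δ → ∀ k₀ : ℕ, ∃ k : ℕ, k₀ ≤ k ∧ CruxAt δ k :=
  Iff.rfl

/-- Degenerate instance: `k = 0` satisfies the matrix for every `δ` (the unique empty row), so the
closure `∀ k₀ ∃ k ≥ k₀` is what keeps the statement honest; conversely for `δ ≥ 5 > log₂ C(7k,k)/k`
a single row works for every `k`, so only small `δ` carries content. -/
theorem cruxAt_zero (δ : ℝ) : CruxAt δ 0 := by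
  refine ⟨{fun i => i.elim0}, ?_, ?_, ?_⟩
  · intro u hu v hv w hw hne
    simp only [Finset.mem_singleton] at hu hv hw
    subst hu; subst hv; subst hw
    simp at hne
  · intro u _
    simp
  · simp

/-! ## §1–§2 Dictionary, cap, forbidden one-sets, load-bearing triples (sorry-free; mirrored in the Negative/ proposal) -/


/-- Pointwise form of the pattern condition: `(a,b,c)` is NOT an admissible column pattern iff the
three events `a = 0`, `b = 1`, `c = 2` do not hold for exactly two of them, i.e. iff the pairwise
conjunctions all agree. [folklore] -/
theorem notMem_patterns_iff (a b c : Fin 3) :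
    (a, b, c) ∉ ({((0 : Fin 3), (1 : Fin 3), (0 : Fin 3)), (0, 1, 1), (0, 0, 2), (0, 2, 2), (1, 1, 2),
        (2, 1, 2)} : Finset (Fin 3 × Fin 3 × Fin 3)) ↔
      ((a = 0 ∧ b = 1 ↔ a = 0 ∧ c = 2) ∧ (a = 0 ∧ b = 1 ↔ b = 1 ∧ c = 2)) := by
  revert a b c
  decide

/-- **Δ-system dictionary.** An ordered triple of rows `(u, v, w)` has no admissible column iff
`Z(u) ∩ O(v) = Z(u) ∩ T(w) = O(v) ∩ T(w)`, where `Z`, `O`, `T` are the coordinate sets carrying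
the symbols `0`, `1`, `2`. [folklore] -/
theorem no_witness_iff {n : ℕ} (u v w : Fin n → Fin 3) :
    (¬ ∃ i, (u i, v i, w i) ∈ ({((0 : Fin 3), (1 : Fin 3), (0 : Fin 3)), (0, 1, 1), (0, 0, 2),
        (0, 2, 2), (1, 1, 2), (2, 1, 2)} : Finset (Fin 3 × Fin 3 × Fin 3))) ↔
      ((univ.filter fun i => u i = 0) ∩ (univ.filter fun i => v i = 1) =
          (univ.filter fun i => u i = 0) ∩ (univ.filter fun i => w i = 2) ∧
        (univ.filter fun i => u i = 0) ∩ (univ.filter fun i => v i = 1) =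
          (univ.filter fun i => v i = 1) ∩ (univ.filter fun i => w i = 2)) := by
  simp only [not_exists, Finset.ext_iff, mem_inter, mem_filter, mem_univ, true_and]
  constructor
  · intro h
    exact ⟨fun i => ((notMem_patterns_iff _ _ _).1 (h i)).1,
      fun i => ((notMem_patterns_iff _ _ _).1 (h i)).2⟩
  · rintro ⟨h1, h2⟩ i
    exact (notMem_patterns_iff _ _ _).2 ⟨h1 i, h2 i⟩

/-- The one-set map `u ↦ O(u)` is injective on any local strong USP (apply the condition to the
ordered triple `(u, v, u)`: the only patterns with equal outer letters are `(0,1,0)` and `(2,1,2)`).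
[folklore] -/
theorem oneSet_injOn {n : ℕ} (U : Finset (Fin n → Fin 3))
    (hU : ∀ u ∈ U, ∀ v ∈ U, ∀ w ∈ U, (u ≠ v ∨ v ≠ w) → ∃ i, (u i, v i, w i) ∈
      ({((0 : Fin 3), (1 : Fin 3), (0 : Fin 3)), (0, 1, 1), (0, 0, 2), (0, 2, 2), (1, 1, 2),
        (2, 1, 2)} : Finset (Fin 3 × Fin 3 × Fin 3))) :
    Set.InjOn (fun u : Fin n → Fin 3 => univ.filter fun i => u i = 1) (U : Set (Fin n → Fin 3)) := by
  intro u hu v hv huv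
  by_contra hne
  obtain ⟨i, hi⟩ := hU u hu v hv u hu (Or.inl hne)
  have key : v i = 1 ∧ u i ≠ 1 := by
    simp only [mem_insert, mem_singleton, Prod.mk.injEq] at hi
    rcases hi with ⟨h1, h2, h3⟩ | ⟨h1, h2, h3⟩ | ⟨h1, h2, h3⟩ | ⟨h1, h2, h3⟩ | ⟨h1, h2, h3⟩ |
        ⟨h1, h2, h3⟩
    · exact ⟨h2, by rw [h1]; decide⟩
    · rw [h1] at h3; exact absurd h3 (by decide)
    · rw [h1] at h3; exact absurd h3 (by decide)
    · rw [h1] at h3; exact absurd h3 (by decide)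
    · rw [h1] at h3; exact absurd h3 (by decide)
    · exact ⟨h2, by rw [h1]; decide⟩
  have hmem : i ∈ univ.filter fun j => v j = 1 := by simp [key.1]
  have huv' : (univ.filter fun j => u j = 1) = univ.filter fun j => v j = 1 := huv
  rw [← huv'] at hmem
  simp only [mem_filter, mem_univ, true_and] at hmem
  exact key.2 hmem

/-- **Unique-pieces cap.** A local strong USP all of whose rows have exactly `k` ones, inside
`{0,1,2}^{7k}`, has at most `C(7k, k)` rows. (The crux `SkewLocalStrongUSP` asks for
`|U| ≥ C(7k,k) · 2^{-δk}`, i.e. for this cap up to a subexponential-in-`7k` factor.) [folklore] -/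
theorem card_le_choose {k : ℕ} (U : Finset (Fin (7 * k) → Fin 3))
    (hU : ∀ u ∈ U, ∀ v ∈ U, ∀ w ∈ U, (u ≠ v ∨ v ≠ w) → ∃ i, (u i, v i, w i) ∈
      ({((0 : Fin 3), (1 : Fin 3), (0 : Fin 3)), (0, 1, 1), (0, 0, 2), (0, 2, 2), (1, 1, 2),
        (2, 1, 2)} : Finset (Fin 3 × Fin 3 × Fin 3)))
    (hO : ∀ u ∈ U, (univ.filter fun i => u i = 1).card = k) :
    U.card ≤ (7 * k).choose k := by
  calc U.card ≤ ((univ : Finset (Fin (7 * k))).powersetCard k).card :=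
        Finset.card_le_card_of_injOn (fun u : Fin (7 * k) → Fin 3 => univ.filter fun i => u i = 1)
          (fun u hu => Finset.mem_coe.2 (mem_powersetCard.2 ⟨filter_subset _ _, hO u (Finset.mem_coe.1 hu)⟩))
          (oneSet_injOn U hU)
    _ = (7 * k).choose k := by
        rw [card_powersetCard, card_univ, Fintype.card_fin]

/-- **Forbidden one-sets.** If `u ≠ w` are rows of a local strong USP `U` and a set `S` of
coordinates is sandwiched as `Z(u) ∩ S = Z(u) ∩ T(w) = S ∩ T(w)` (equivalently
`K ⊆ S ⊆ K ∪ (Z(u) ∪ T(w))ᶜ` with `K = Z(u) ∩ T(w)`), then `S` is the one-set of NO row of `U`: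
otherwise `(u, v, w)` would be a triple without an admissible column. [folklore] -/
theorem oneSet_ne_of_sandwich {n : ℕ} (U : Finset (Fin n → Fin 3))
    (hU : ∀ u ∈ U, ∀ v ∈ U, ∀ w ∈ U, (u ≠ v ∨ v ≠ w) → ∃ i, (u i, v i, w i) ∈
      ({((0 : Fin 3), (1 : Fin 3), (0 : Fin 3)), (0, 1, 1), (0, 0, 2), (0, 2, 2), (1, 1, 2),
        (2, 1, 2)} : Finset (Fin 3 × Fin 3 × Fin 3)))
    {u w : Fin n → Fin 3} (hu : u ∈ U) (hw : w ∈ U) (huw : u ≠ w) (S : Finset (Fin n))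
    (h1 : (univ.filter fun i => u i = 0) ∩ S =
      (univ.filter fun i => u i = 0) ∩ (univ.filter fun i => w i = 2))
    (h2 : (univ.filter fun i => u i = 0) ∩ S = S ∩ (univ.filter fun i => w i = 2)) :
    ∀ v ∈ U, (univ.filter fun i => v i = 1) ≠ S := by
  intro v hv hvS
  have hne : u ≠ v ∨ v ≠ w := by
    by_cases h : u = v
    · right
      rw [← h]
      exact huw
    · exact Or.inl h
  have hex := hU u hu v hv w hw hne
  refine (no_witness_iff u v w).2 ?_ hex
  rw [hvS]
  exact ⟨h1, h2⟩

/-- In a row with `3k` zeros and `k` ones (width `7k`) the two-set has `3k` elements. [folklore] -/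
theorem card_twoSet {k : ℕ} (u : Fin (7 * k) → Fin 3)
    (h0 : (univ.filter fun i => u i = 0).card = 3 * k) (h1 : (univ.filter fun i => u i = 1).card = k) :
    (univ.filter fun i => u i = 2).card = 3 * k := by
  have hA := Finset.card_filter_add_card_filter_not (s := (univ : Finset (Fin (7 * k))))
    (fun i => u i = 0)
  have hB := Finset.card_filter_add_card_filter_not
    (s := (univ : Finset (Fin (7 * k))).filter fun i => ¬ u i = 0) (fun i => u i = 1)
  rw [Finset.filter_filter, Finset.filter_filter] at hB
  have e1 : (univ.filter fun i => ¬u i = 0 ∧ u i = 1) = univ.filter fun i => u i = 1 := by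
    apply Finset.filter_congr
    intro i _
    constructor
    · exact fun h => h.2
    · intro h
      rw [h]
      exact ⟨by decide, rfl⟩
  have e2 : (univ.filter fun i => ¬u i = 0 ∧ ¬u i = 1) = univ.filter fun i => u i = 2 := by
    apply Finset.filter_congr
    intro i _
    have : ∀ a : Fin 3, (¬a = 0 ∧ ¬a = 1) ↔ a = 2 := by decide
    exact this (u i)
  rw [e1, e2, h1] at hB
  rw [h0, card_univ, Fintype.card_fin] at hA
  omega

/-- **A family meeting the cap has only thick cross-intersections.** If a local strong USP in the
class `(3k, k, 3k)` has (at least, hence exactly) `C(7k, k)` rows, then every `k`-set of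
coordinates is the one-set of some row, and consequently `|Z(u) ∩ T(w)| ≥ k + 1` for all rows
`u ≠ w` (otherwise the kernel `K = Z(u) ∩ T(w)` extends inside `(Z(u) ∪ T(w))ᶜ`, which has
`k + |K|` elements, to a `k`-set that is forbidden by `oneSet_ne_of_sandwich` yet realised).
Füredi's threshold version of the Bollobás two-families theorem then bounds the number of rows by
`C(4k, 2k) < C(7k, k)` — so the cap is never met (`k ≥ 1`); see the crux work file. [folklore] -/
theorem lt_card_inter_of_choose_le_card {k : ℕ} (U : Finset (Fin (7 * k) → Fin 3))
    (hU : ∀ u ∈ U, ∀ v ∈ U, ∀ w ∈ U, (u ≠ v ∨ v ≠ w) → ∃ i, (u i, v i, w i) ∈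
      ({((0 : Fin 3), (1 : Fin 3), (0 : Fin 3)), (0, 1, 1), (0, 0, 2), (0, 2, 2), (1, 1, 2),
        (2, 1, 2)} : Finset (Fin 3 × Fin 3 × Fin 3)))
    (hS : ∀ u ∈ U, (univ.filter fun i => u i = 0).card = 3 * k ∧ (univ.filter fun i => u i = 1).card = k)
    (hcard : (7 * k).choose k ≤ U.card) :
    ∀ u ∈ U, ∀ w ∈ U, u ≠ w →
      k < ((univ.filter fun i => u i = 0) ∩ (univ.filter fun i => w i = 2)).card := by
  classical
  -- every k-set of coordinates is realised as a one-set
  have hsurj : ∀ S ∈ (univ : Finset (Fin (7 * k))).powersetCard k, ∃ v ∈ U,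
      (univ.filter fun i => v i = 1) = S := by
    intro S hSmem
    have h := Finset.surj_on_of_inj_on_of_card_le
      (s := U) (t := (univ : Finset (Fin (7 * k))).powersetCard k)
      (fun u _ => univ.filter fun i => u i = 1)
      (fun u hu => by
        rw [mem_powersetCard]
        exact ⟨filter_subset _ _, (hS u hu).2⟩)
      (fun a b ha hb hab => oneSet_injOn U hU ha hb hab)
      (by rwa [card_powersetCard, card_univ, Fintype.card_fin])
      S hSmem
    obtain ⟨v, hv, hvS⟩ := h
    exact ⟨v, hv, hvS.symm⟩
  intro u hu w hw huw
  by_contra hle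
  rw [Nat.not_lt] at hle
  set Z : Finset (Fin (7 * k)) := univ.filter fun i => u i = 0 with hZ
  set T : Finset (Fin (7 * k)) := univ.filter fun i => w i = 2 with hT
  set K : Finset (Fin (7 * k)) := Z ∩ T with hK
  set R : Finset (Fin (7 * k)) := (Z ∪ T)ᶜ with hR
  have hZc : Z.card = 3 * k := (hS u hu).1
  have hTc : T.card = 3 * k := card_twoSet w (hS w hw).1 (hS w hw).2
  have hKZT : K = Z ∩ T := hK
  have hRc : R.card = k + K.card := by
    have h1 := Finset.card_union_add_card_inter Z T
    rw [← hKZT] at h1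
    have h2 : R.card = 7 * k - (Z ∪ T).card := by
      rw [hR, Finset.card_compl, Fintype.card_fin]
    have h3 : (Z ∪ T).card ≤ 7 * k := by
      calc (Z ∪ T).card ≤ (univ : Finset (Fin (7 * k))).card := card_le_card (subset_univ _)
        _ = 7 * k := by rw [card_univ, Fintype.card_fin]
    have h4 : K.card ≤ 3 * k := by
      calc K.card ≤ Z.card := card_le_card inter_subset_left
        _ = 3 * k := hZc
    omega
  -- extend the kernel K inside R to a k-set S
  obtain ⟨Q, hQR, hQc⟩ : ∃ Q ⊆ R, Q.card = k - K.card :=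
    Finset.exists_subset_card_eq (by omega)
  have hQZ : Disjoint Q Z := by
    rw [Finset.disjoint_left]
    intro i hiQ hiZ
    have hiR := hQR hiQ
    rw [hR, mem_compl] at hiR
    exact hiR (mem_union_left _ hiZ)
  have hQT : Disjoint Q T := by
    rw [Finset.disjoint_left]
    intro i hiQ hiT
    have hiR := hQR hiQ
    rw [hR, mem_compl] at hiR
    exact hiR (mem_union_right _ hiT)
  have hKQ : Disjoint K Q := by
    rw [Finset.disjoint_left]
    intro i hiK hiQ
    exact (Finset.disjoint_left.1 hQZ) hiQ (inter_subset_left hiK)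
  set S : Finset (Fin (7 * k)) := K ∪ Q with hSdef
  have hSc : S.card = k := by
    rw [hSdef, card_union_of_disjoint hKQ, hQc]
    omega
  have hSmem : S ∈ (univ : Finset (Fin (7 * k))).powersetCard k := by
    rw [mem_powersetCard]
    exact ⟨subset_univ _, hSc⟩
  obtain ⟨v, hv, hvS⟩ := hsurj S hSmem
  -- the sandwich identities
  have e1 : Z ∩ S = Z ∩ T := by
    rw [hSdef, inter_union_distrib_left, disjoint_iff_inter_eq_empty.1 hQZ.symm, union_empty, hK]
    rw [← inter_assoc, inter_self]
  have e2 : Z ∩ S = S ∩ T := by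
    rw [e1, hSdef, union_inter_distrib_right, disjoint_iff_inter_eq_empty.1 hQT, union_empty, hK,
      inter_assoc, inter_self]
  exact oneSet_ne_of_sandwich U hU hu hw huw S e1 e2 v hv hvS

/-- **The degenerate triples are what bites.** If three rows `u, v, w` share the same one-set and
`u ≠ w` have zero-sets of equal size, then `(u, v, w)` HAS an admissible column. Hence the family
of ALL rows of the class `(3k, k, 3k)` with one fixed one-set — `C(6k, 3k) ≫ C(7k, k)` rows —
satisfies the crux's column condition on every triple of pairwise DISTINCT rows: the variant of
`SkewLocalStrongUSP` quantifying only over pairwise distinct triples is trivially true, and all the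
content of the crux sits in the degenerate triples `(u,v,u)`, `(u,u,w)`, `(u,w,w)` (injectivity of
the three coordinate-set maps, whence the cap `card_le_choose`). [folklore] -/
theorem exists_witness_of_common_oneSet {n : ℕ} {u v w : Fin n → Fin 3}
    (huv : (univ.filter fun i => u i = 1) = univ.filter fun i => v i = 1)
    (huw1 : (univ.filter fun i => u i = 1) = univ.filter fun i => w i = 1)
    (hZ : (univ.filter fun i => u i = 0).card = (univ.filter fun i => w i = 0).card)
    (huw : u ≠ w) :
    ∃ i, (u i, v i, w i) ∈ ({((0 : Fin 3), (1 : Fin 3), (0 : Fin 3)), (0, 1, 1), (0, 0, 2),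
        (0, 2, 2), (1, 1, 2), (2, 1, 2)} : Finset (Fin 3 × Fin 3 × Fin 3)) := by
  by_contra h
  obtain ⟨e1, _⟩ := (no_witness_iff u v w).1 h
  -- `Z(u) ∩ O(v) = Z(u) ∩ O(u) = ∅`, hence `Z(u) ∩ T(w) = ∅`
  have hempty : (univ.filter fun i => u i = 0) ∩ (univ.filter fun i => w i = 2) = ∅ := by
    rw [← e1, ← huv]
    ext i
    simp only [mem_inter, mem_filter, mem_univ, true_and, notMem_empty, iff_false, not_and]
    intro h0 h1
    rw [h0] at h1
    exact absurd h1 (by decide)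
  have hOw : ∀ i, u i = 1 ↔ w i = 1 := fun i => by
    have := congrArg (fun s : Finset (Fin n) => i ∈ s) huw1
    simpa using this
  -- `Z(u) ⊆ Z(w)`, hence equal (same size)
  have hsub : (univ.filter fun i => u i = 0) ⊆ univ.filter fun i => w i = 0 := by
    intro i hi
    simp only [mem_filter, mem_univ, true_and] at hi ⊢
    have hfin : ∀ a : Fin 3, a = 0 ∨ a = 1 ∨ a = 2 := by decide
    rcases hfin (w i) with h0 | h1 | h2
    · exact h0
    · have := (hOw i).2 h1
      rw [hi] at this
      exact absurd this (by decide)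
    · have hmem : i ∈ (univ.filter fun j => u j = 0) ∩ (univ.filter fun j => w j = 2) := by
        simp [hi, h2]
      rw [hempty] at hmem
      exact absurd hmem (notMem_empty _)
  have heq : (univ.filter fun i => u i = 0) = univ.filter fun i => w i = 0 :=
    Finset.eq_of_subset_of_card_le hsub hZ.ge
  have hZw : ∀ i, u i = 0 ↔ w i = 0 := fun i => by
    have := congrArg (fun s : Finset (Fin n) => i ∈ s) heq
    simpa using this
  apply huw
  funext i
  have hfin : ∀ a : Fin 3, a = 0 ∨ a = 1 ∨ a = 2 := by decide
  rcases hfin (u i) with h0 | h1 | h2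
  · rw [h0, ((hZw i).1 h0)]
  · rw [h1, ((hOw i).1 h1)]
  · rcases hfin (w i) with g0 | g1 | g2
    · have := (hZw i).2 g0
      rw [h2] at this
      exact absurd this (by decide)
    · have := (hOw i).2 g1
      rw [h2] at this
      exact absurd this (by decide)
    · rw [h2, g2]


/-! ## §3 The exact cap is unattainable (modulo Füredi 1984) -/

/-- **Füredi's threshold form of the Bollobás two-families theorem** (Z. Füredi, *Geometrical solution
of an intersection problem for two hypergraphs*, European J. Combin. 5 (1984) 133–136, Theorem 1;
Babai–Frankl, *Linear Algebra Methods in Combinatorics*, §5): if `A_1..A_m` are `a`-sets and `B_1..B_m`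
are `b`-sets with `|A_i ∩ B_i| ≤ t` and `|A_i ∩ B_j| > t` for all `i ≠ j`, then
`m ≤ C(a + b - 2t, a - t)` (tight: a common `t`-kernel plus complementary pairs in an `(a+b-2t)`-set;
`t = 0` is Bollobás 1965).  Literature fact, NOT in Mathlib (exterior-algebra / general-position proof);
used here only as the hypothesis of `card_le_of_exact_of_furedi`.
[cite: Füredi 1984, European J. Combin. 5, 133–136, Thm. 1] -/
def FurediThreshold : Prop :=
  ∀ (n m a b t : ℕ) (A B : Fin m → Finset (Fin n)),
    (∀ i, (A i).card = a) → (∀ i, (B i).card = b) → (∀ i, (A i ∩ B i).card ≤ t) →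
    (∀ i j, i ≠ j → t < (A i ∩ B j).card) → m ≤ (a + b - 2 * t).choose (a - t)

/-- `CruxExact`: the crux with the slack `2^{δk}` replaced by `1` — cap-meeting skew local strong USPs
for infinitely many `k`. Refuted below (for `k ≤ 12`, and on paper for all `k`) modulo `FurediThreshold`. -/
def CruxExact : Prop :=
  ∀ k₀ : ℕ, ∃ k : ℕ, k₀ ≤ k ∧ ∃ U : Finset (Fin (7 * k) → Fin 3),
    (∀ u ∈ U, ∀ v ∈ U, ∀ w ∈ U, (u ≠ v ∨ v ≠ w) → ∃ i,
      (u i, v i, w i) ∈ ({((0 : Fin 3), (1 : Fin 3), (0 : Fin 3)), (0, 1, 1), (0, 0, 2), (0, 2, 2),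
        (1, 1, 2), (2, 1, 2)} : Finset (Fin 3 × Fin 3 × Fin 3))) ∧
    (∀ u ∈ U, (Finset.univ.filter fun i => u i = 0).card = 3 * k ∧
      (Finset.univ.filter fun i => u i = 1).card = k) ∧
    (7 * k).choose k ≤ U.card

/-- **Cap-meeting families are small (mod Füredi).** A local strong USP in the class `(3k,k,3k)` with
`≥ C(7k,k)` rows has at most `C(4k, 2k)` rows: by `lt_card_inter_of_choose_le_card` the pairs
`(Z(u), T(u))` form a threshold set-pair system (`|Z(u) ∩ T(u)| = 0 ≤ k`, `|Z(u) ∩ T(w)| > k` for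
`u ≠ w`) of `3k`-sets, and Füredi's theorem applies with `a = b = 3k`, `t = k`. -/
theorem card_le_of_exact_of_furedi (hF : FurediThreshold) {k : ℕ} (U : Finset (Fin (7 * k) → Fin 3))
    (hU : ∀ u ∈ U, ∀ v ∈ U, ∀ w ∈ U, (u ≠ v ∨ v ≠ w) → ∃ i, (u i, v i, w i) ∈
      ({((0 : Fin 3), (1 : Fin 3), (0 : Fin 3)), (0, 1, 1), (0, 0, 2), (0, 2, 2), (1, 1, 2),
        (2, 1, 2)} : Finset (Fin 3 × Fin 3 × Fin 3)))
    (hS : ∀ u ∈ U, (univ.filter fun i => u i = 0).card = 3 * k ∧ (univ.filter fun i => u i = 1).card = k)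
    (hcard : (7 * k).choose k ≤ U.card) :
    U.card ≤ (4 * k).choose (2 * k) := by
  classical
  have hthick := lt_card_inter_of_choose_le_card U hU hS hcard
  set m := U.card with hm
  let e : Fin m ≃ U := (U.equivFin).symm
  let A : Fin m → Finset (Fin (7 * k)) := fun i => univ.filter fun j => (e i).1 j = 0
  let B : Fin m → Finset (Fin (7 * k)) := fun i => univ.filter fun j => (e i).1 j = 2
  have hA : ∀ i, (A i).card = 3 * k := fun i => (hS _ (e i).2).1
  have hB : ∀ i, (B i).card = 3 * k := fun i => card_twoSet _ (hS _ (e i).2).1 (hS _ (e i).2).2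
  have hdiag : ∀ i, (A i ∩ B i).card ≤ k := fun i => by
    have : A i ∩ B i = ∅ := by
      ext j
      simp only [A, B, mem_inter, mem_filter, mem_univ, true_and, notMem_empty, iff_false, not_and]
      intro h0 h2
      rw [h0] at h2
      exact absurd h2 (by decide)
    rw [this, card_empty]
    exact Nat.zero_le _
  have hoff : ∀ i j, i ≠ j → k < (A i ∩ B j).card := fun i j hij => by
    have hne : (e i).1 ≠ (e j).1 := fun h => hij (e.injective (Subtype.ext h))
    exact hthick _ (e i).2 _ (e j).2 hne
  have h := hF (7 * k) m (3 * k) (3 * k) k A B hA hB hdiag hoff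
  have e1 : 3 * k + 3 * k - 2 * k = 4 * k := by omega
  have e2 : 3 * k - k = 2 * k := by omega
  rwa [e1, e2] at h

/-- `C(4k, 2k) < C(7k, k)` for `1 ≤ k ≤ 12` (kernel-checked); asymptotically `2^{4k}/√k` versus
`2^{4.1417k}/√k`, ratio `2^{0.1417k}` — true for every `k ≥ 1`, the general case being a routine but
unrewarding Stirling estimate left out of this file. -/
theorem choose_four_two_lt : ∀ k ∈ Finset.Icc 1 12, (4 * k).choose (2 * k) < (7 * k).choose k := by
  decide

/-- **The exact cap is never met for `1 ≤ k ≤ 12`, modulo Füredi** (and, by the estimate above, for any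
`k ≥ 1`): the slack `2^{δk}` in the crux cannot be dropped. -/
theorem card_lt_choose_of_furedi (hF : FurediThreshold) {k : ℕ} (hk : k ∈ Finset.Icc 1 12)
    (U : Finset (Fin (7 * k) → Fin 3))
    (hU : ∀ u ∈ U, ∀ v ∈ U, ∀ w ∈ U, (u ≠ v ∨ v ≠ w) → ∃ i, (u i, v i, w i) ∈
      ({((0 : Fin 3), (1 : Fin 3), (0 : Fin 3)), (0, 1, 1), (0, 0, 2), (0, 2, 2), (1, 1, 2),
        (2, 1, 2)} : Finset (Fin 3 × Fin 3 × Fin 3)))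
    (hS : ∀ u ∈ U, (univ.filter fun i => u i = 0).card = 3 * k ∧ (univ.filter fun i => u i = 1).card = k) :
    U.card < (7 * k).choose k := by
  by_contra hge
  rw [Nat.not_lt] at hge
  have h1 := card_le_of_exact_of_furedi hF U hU hS hge
  have h2 := choose_four_two_lt k hk
  omega

/-! ## §4 Why it resists: the embedding/slice-rank paradigm is silent at `a = 1/3` (documentation)

PARADIGM.  Every known kill mechanism for USP-capacity statements is: choose an abelian `p`-group `G`
and nine subsets `X_a, Y_a, W_a ⊆ G` (`a = 0,1,2`), map a row `u` to the boxes
`X_u = ∏_i X_{u_i}`, `Y_u = ∏ Y_{u_i}`, `W_u = ∏ W_{u_i}` in `G^{7k}`; if the six CROSS blocks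
`X_a + Y_b + W_c` avoid `0` for `(a,b,c) ∈ E_rot = {exactly two of a=1, b=2, c=0}` (the crux's pattern
set read on the rotated triple `(w,u,v)`, as in CKSU's proof of Thm 33), the local strong USP makes the
restriction of `T_{G^{7k}}` (`T_G(x,y,z) = [x+y+z=0]` over `𝔽_p`) to these boxes BLOCK DIAGONAL:
`⊕_{u ∈ U} S ≤ T_G^{⊗7k}`, `S = B_0^{⊗3k} ⊗ B_1^{⊗k} ⊗ B_2^{⊗3k}`, `B_a = T_G|_{X_a × Y_a × W_a}`.
Hence for asymptotic subrank (additive, multiplicative on powers, monotone):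
`|U| · Q̃(S) ≤ Q̃(T_G)^{7k} ≤ Γ(G)^{7k}` (BCCGNSU slice rank, `Γ(𝔽_p^d) = Γ_p^d`,
`Γ_p = min_t (1-t^p)/((1-t)t^{(p-1)/3})`: `Γ₂ = 1.88988, Γ₃ = 2.75510, Γ₅ = 4.46158, Γ₇ = 6.15620`).
CKSU's Thm 33 (and Alon–Shpilka–Umans 2013 Thm 3.7, which is the `G = F₃` instance with Strassen's
`3N²/4` diagonal in place of asymptotic degeneration: strong USP capacity `≤ (3/2^{2/3})^{1-ε₀}`) is the
choice `P := X_1 = Q := Y_2 = R := W_0 = {0}`, all other sets `G ∖ {0}`, blocks =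
pairings of size `m = |G|-1`, `S` (after `S₃`-symmetrisation) `= ⟨m^{3k}, m^{3k}, m^k⟩`, value `m^{14k/3}`:
kill iff `Γ(G)^7 / m^{14/3} < 7⁷/6⁶ = 2^{7 h(1/7)} = 17.651`; per-coordinate RATE
`log₂Γ(G) - (2/3)log₂ m` must be `< h(1/7) = 0.5917` bits:
`F₂: 0.918, F₃: 0.795, F₂²: 0.780, F₅: 0.824, F₇: 0.899, F₈: 0.883, F₉: 0.924`.  NO.
(= the route's `a₀(ℓ) ≈ 0.67–0.69 > 1/3`, re-derived.)

NEW 1 (all block choices, small groups — rigorous).  For ANY `(P,Q,R)` the non-special sets are at best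
`A_W = G ∖ -(P+Q)`, `A_Y = G ∖ -(P+R)`, `A_X = G ∖ -(Q+R)` (bigger sets = bigger restrictions, `Q̃`
monotone), and `Q̃` of ANY degeneration of the symmetrised `S` is at most the product of its flattening
ranks, i.e. per block at most the geometric mean `gm(B_a)` of the three flattening ranks.
`paradigm/proxy_enum.py` enumerates every `(P,Q,R)` in `F₂, F₃, F₂², F₅` (2 / 18 / 92 / 870 admissible
configurations up to translation; ranks over `𝔽_p`): the maximum of
`3 log₂ gm(B_0) + log₂ gm(B_1) + 3 log₂ gm(B_2)` is attained EXACTLY at CKSU's configuration, giving the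
same rates `0.918 / 0.795 / 0.780 / 0.824 > 0.5917`.  For every cyclic group of prime order and for
`F₈, F₉` the crude bound `gm(B_a) ≤ ((|G|-s)² s)^{1/3} ≤ (4/27)^{1/3}|G|` (`s` = size of the block's
special set; `|P+Q| ≥ |P|`) excludes a kill whenever `Γ(G)/|G| > 0.52913·1.50702 = 0.79741`, and
`Γ_p/p ↓ 0.8414` (BCCGNSU), `Γ(F₈)/8 = 0.844`, `Γ(F₉)/9 = 0.843`.  For `F₁₆, F₂₅, F₂₇, …` the
flattening proxy is too generous to decide, but every design there that we can evaluate factors through a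
subgroup `H` (special sets = cosets: the `H`-part is cost-neutral at best, `Q̃(T_H) ≤ Γ(H)`) and pays the
pairing penalty `m ≤ |G/H| - 1` on the quotient — no configuration with rate `< 0.78` is known to us.

NEW 2 (support functionals do not interpolate).  Replacing "symmetrise + slice rank" by Strassen's upper
support functionals, `|U|^{1/k} ≤ min_θ ρ^θ(Φ_p)^7 / ∏_a ζ^θ(B_a)^{n_a}` with `Φ_p` the degree support
`{(0,0,0)} ∪ {a+b+c = p-1}` of `T_{𝔽_p}`: for CKSU blocks the denominator is `m^{4+2θ_X}`, the bound is
log-convex in `θ`, equals the Thm-B bound at `θ = (1/3,1/3,1/3)` and PURE COUNTING `p⁷/(p-1)⁶` at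
`θ = (1,0,0)` — which is `7⁷/6⁶ = 2^{7h(1/7)}` on the nose at `p = 7` (the trivial cap) and larger for
every other `p`; the one-sided derivative at `θ_X = 1` is
`7·(log₂ p - max{(H(P_b)+H(P_c))/2 : P on Φ_p, P_a uniform}) - 2 log₂(p-1) = -2.1` bits at `p = 7`,
`≈ 0` at `p = 3` (where the endpoint value is `3⁷/2⁶ = 34 ≫ 17.65`): the minimum sits at an endpoint
for every `p`; no interior gain.  Allowing `|P| = s > 1` at `θ = (1,0,0)` reproduces
`min_s p⁷/(s (p-s)⁶) → 7·(7/6)⁶` — counting can never beat counting.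

NEW 3 (what a witness must look like).  §3: tight pairs (`|Z(u) ∩ T(w)| ≤ k`) are FORCED
(independence number of the tight-pair graph `≤ C(4k,2k) = 2^{4k(1-o(1))} < C(7k,k) = 2^{4.1417k}`),
although a uniformly random pair has `|Z ∩ T| ≈ 9k/7`; each tight pair with kernel size `j` forbids the
`C(k+j,2j)` one-sets `K ⊔ Q`, `Q ⊆ (Z(u) ∪ T(w))ᶜ` (`oneSet_ne_of_sandwich`).  In the sparse regime
(`|U| ≈ 2^{-6k}` of the class) this is a design constraint, not a contradiction: one absent `k`-set is
"explained" by up to `Σ_j C(k,j)·multinomial(6k; 3k-j, 3k-j, 2j) ≈ 2^{9.9k} > |U|²` pairs.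

NEW 4 (relaxations that are TRUE, so cannot be the route to a kill): the `∅`-kernel part alone (local
WEAK USP in the skew type, equivalently tricoloured sum-free sets `(1_{Z(u)}, 1_{O(u)}, 1_{Z(u)∪O(u)})` in
`𝔽₂^{7k}` with weights `(3k,k,4k)`) reaches `C(7k,k)^{1-o(1)}` by CW hashing (NOTES §F2); the typed degree
method on that tensor is `≥ C(7k,k)` for every split `(s₀,r₀,q₀)` (the `y`-side span on weight-`k` vectors
is all of `C(7k,k)` unless `r₀ < k`, forcing `s₀ + q₀ > 6k`).  Products/symbol permutations preserve local
strong USPs (`U × π(U) × π²(U)` is balanced of rate `1.507 < 1.7356`), so no transfer from the balanced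
barrier either.

BOTTOM LINE FOR PROVERS.  A proof = a strong-USP-type construction of rate `2^{h(1/7)}` inside the skew
class, i.e. beating every known strong USP design by a wide margin in a regime where random/greedy/CW all
fail by `2^{Θ(k)}` (nonempty kernels are suppressed only by `M^{-3}` under hashing, one factor `M` short);
the forbidden-one-set lemma is the exact local obstruction to design around.  A disproof = a new upper
bound for a 3-uniform directed Sperner capacity within a type; the linear-algebra/slice-rank family is
exhausted above.  Planner's `L` is optimistic on both sides.
-/

/-- Numeric anchor: `2^{7 h(1/7)} = 7⁷/6⁶ ≈ 17.651` (the per-`k` growth of the cap `C(7k,k)`). -/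
example : (7 : ℚ) ^ 7 / 6 ^ 6 = 823543 / 46656 := by norm_num

/-- Numeric anchor (Thm-B / CKSU at `ℓ = 3` does not bite): with `Γ₃ ≥ 2.755`,
`Γ₃^{21} / 2^{14} > (7⁷/6⁶)³`, i.e. `Γ₃⁷ / 2^{14/3} > 7⁷/6⁶` (per coordinate `1.7356 > 1.507`). -/
example : ((2755 : ℚ) / 1000) ^ 21 / 2 ^ 14 > ((7 : ℚ) ^ 7 / 6 ^ 6) ^ 3 := by norm_num

/-- Numeric anchor (the crude all-blocks no-go for cyclic prime `G`): the threshold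
`(4/27)^{1/3} · (7⁷/6⁶)^{1/7} = 0.79741…` lies below `0.7975`, and `Γ_p/p ≥ 0.8414 > 0.7975` for every
prime `p`; in 21st powers: `0.7975²¹ · 27⁷ > 4⁷ · (7⁷/6⁶)³`. -/
example : ((7975 : ℚ) / 10000) ^ 21 * 27 ^ 7 > 4 ^ 7 * ((7 : ℚ) ^ 7 / 6 ^ 6) ^ 3 := by norm_num

/-- Numeric anchor (pure counting endpoint `θ = (1,0,0)`): `5⁷/4⁶ > 7⁷/6⁶` (and `p = 7` IS the cap). -/
example : (5 : ℚ) ^ 7 / 4 ^ 6 > (7 : ℚ) ^ 7 / 6 ^ 6 := by norm_num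

/-! ## §5 Targets (lead's stuck stubs) — none yet. -/

end Summit.MatrixMultiplication.MatrixMultiplication.Cruxes.SkewLocalStrongUSP.Disproof
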